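import Summits.FinalStateConjecture.FinalStateConjecture.Theorems.EIHFluxBalanceInertialRecessionStubHigherOrderSymbol

/-!
# Route EIHFluxBalance — `InertialRecession` (E′), line `SketchCleanExcision`, skeleton r13,
# stub `stub_higherOrderSlaving` (EF): additivity of the principal symbol in the jet perturbation

Helper file for the crux `stmt-FinalStateConjecture-17403`
(`Summit.FinalStateConjecture.FinalStateConjecture.Theses.EIHFluxBalance.InertialRecession`, E′),
registered stub `stub_higherOrderSlaving` (orders two and three of frozen-vacuum slaving).

The change of `Ric(G)(x)` under a change `ζ ⊗ ζ ⊗ B` of the second jet (resp. of `D[Ric G](x)`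
under `ζ ⊗ ζ ⊗ ζ ⊗ B` of the third jet) is the explicit symbol form `Sym_G(ζ, B)`
(`ricAt_apply_eq_add_symbol_of_jets`, `higherOrder_fderiv_ricAt_apply_eq_add_symbol_of_jet₃`),
which is LINEAR in `B` (`higherOrder_symbolForm_add`). Hence, for two perturbations of the same
field with coefficients `B₁`, `B₂`, the sum of the two Ricci changes is bounded by
`4 ‖♯‖ ‖ζ‖² ‖B₁ + B₂‖` (`higherOrder_norm_ricAt_changes_add_le`, order two;
`higherOrder_norm_ricAt_changes_add_le₃`, mixed orders two/three). In the higher-order slaving steps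
`B₁ = −Pₖ(x)` (removing the `k`-th lab-time variation from the ansatz) and `B₂ = W` (the variation
form of the coercivity statement), so `‖B₁ + B₂‖ = ‖W − Pₖ(x)‖` is the modelling error.

No definitions, no named facts, no `sorry`.
-/

set_option linter.dupNamespace false
set_option maxSynthPendingDepth 6

noncomputable section

namespace Summit.FinalStateConjecture.FinalStateConjecture.Theorems.SublinearIsFree.Slaving

open scoped Topology
open Set Function Literature.Geometry.Lorentzian
open MetricCoord

/-- **The symbol form is additive in the jet coefficient.** [folklore] -/
theorem higherOrder_symbolForm_add (G : E4 → E4 →L[ℝ] E4 →L[ℝ] ℝ) (x : E4) (ζ : E4 →L[ℝ] ℝ)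
    (B₁ B₂ : E4 →L[ℝ] E4 →L[ℝ] ℝ) (Y Z : E4) :
    2⁻¹ * (ζ Z * ζ (sharpAt G x (B₁.flip Y)) + ζ Y * B₁ (sharpAt G x ζ) Z
      - ζ (sharpAt G x ζ) * B₁ Y Z - ζ Y * ζ Z * mtrAt G x B₁.flip) +
    2⁻¹ * (ζ Z * ζ (sharpAt G x (B₂.flip Y)) + ζ Y * B₂ (sharpAt G x ζ) Z
      - ζ (sharpAt G x ζ) * B₂ Y Z - ζ Y * ζ Z * mtrAt G x B₂.flip) =
    2⁻¹ * (ζ Z * ζ (sharpAt G x ((B₁ + B₂).flip Y)) + ζ Y * (B₁ + B₂) (sharpAt G x ζ) Z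
      - ζ (sharpAt G x ζ) * (B₁ + B₂) Y Z - ζ Y * ζ Z * mtrAt G x (B₁ + B₂).flip) := by
  simp only [ContinuousLinearMap.flip_add, _root_.add_apply, map_add, mtrAt_add]
  ring

/-- **Order two: the sum of two Ricci changes with coefficients `B₁`, `B₂` is bounded by
`4 ‖♯‖ ‖ζ‖² ‖B₁ + B₂‖`.** [folklore] -/
theorem higherOrder_norm_ricAt_changes_add_le {G G₁ G₂ : E4 → E4 →L[ℝ] E4 →L[ℝ] ℝ} {V : Set E4}
    {x : E4} (hG : IsMetricOn G V) (hG₁ : IsMetricOn G₁ V) (hG₂ : IsMetricOn G₂ V) (hx : x ∈ V)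
    {ζ : E4 →L[ℝ] ℝ} {B₁ B₂ : E4 →L[ℝ] E4 →L[ℝ] ℝ}
    (h10 : G₁ x = G x) (h11 : fderiv ℝ G₁ x = fderiv ℝ G x)
    (h12 : ∀ v, fderiv ℝ (fderiv ℝ G₁) x v = fderiv ℝ (fderiv ℝ G) x v + ζ v • ζ.smulRight B₁)
    (h20 : G₂ x = G x) (h21 : fderiv ℝ G₂ x = fderiv ℝ G x)
    (h22 : ∀ v, fderiv ℝ (fderiv ℝ G₂) x v = fderiv ℝ (fderiv ℝ G) x v + ζ v • ζ.smulRight B₂) :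
    ‖(ricAt G₁ x - ricAt G x) + (ricAt G₂ x - ricAt G x)‖ ≤ 4 * ‖sharpAt G x‖ * ‖ζ‖ ^ 2 * ‖B₁ + B₂‖ := by
  refine higherOrder_opNorm_bilin_le (by positivity) fun Y Z ↦ ?_
  rw [_root_.add_apply, _root_.add_apply, _root_.sub_apply, _root_.sub_apply, _root_.sub_apply,
    _root_.sub_apply, ricAt_apply_eq_add_symbol_of_jets hG hG₁ hx h10 h11 h12 Y Z,
    ricAt_apply_eq_add_symbol_of_jets hG hG₂ hx h20 h21 h22 Y Z, add_sub_cancel_left,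
    add_sub_cancel_left, higherOrder_symbolForm_add]
  exact higherOrder_abs_symbol_apply_le G x ζ (B₁ + B₂) Y Z

/-- **Mixed orders: a third-jet change with coefficient `B₁` and a second-jet change with
coefficient `B₂`**: `‖(D[Ric G₁](x)v − D[Ric G](x)v) + ζ(v) (Ric G₂(x) − Ric G(x))‖ ≤
4 ‖♯‖ ‖ζ‖² ‖B₁ + B₂‖ |ζ v|`. [folklore] -/
theorem higherOrder_norm_ricAt_changes_add_le₃ {G G₁ G₂ : E4 → E4 →L[ℝ] E4 →L[ℝ] ℝ} {V : Set E4}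
    {x : E4} (hG : IsMetricOn G V) (hG₁ : IsMetricOn G₁ V) (hG₂ : IsMetricOn G₂ V) (hx : x ∈ V)
    {ζ : E4 →L[ℝ] ℝ} {B₁ B₂ : E4 →L[ℝ] E4 →L[ℝ] ℝ} (hB₁ : ∀ v w, B₁ v w = B₁ w v)
    (h10 : G₁ x = G x) (h11 : fderiv ℝ G₁ x = fderiv ℝ G x)
    (h12 : fderiv ℝ (fderiv ℝ G₁) x = fderiv ℝ (fderiv ℝ G) x)
    (h13 : ∀ v, fderiv ℝ (fderiv ℝ (fderiv ℝ G₁)) x v =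
      fderiv ℝ (fderiv ℝ (fderiv ℝ G)) x v + ζ v • ζ.smulRight (ζ.smulRight B₁))
    (h20 : G₂ x = G x) (h21 : fderiv ℝ G₂ x = fderiv ℝ G x)
    (h22 : ∀ v, fderiv ℝ (fderiv ℝ G₂) x v = fderiv ℝ (fderiv ℝ G) x v + ζ v • ζ.smulRight B₂) (v : E4) :
    ‖(fderiv ℝ (ricAt G₁) x v - fderiv ℝ (ricAt G) x v) + (ζ v) • (ricAt G₂ x - ricAt G x)‖ ≤
      4 * ‖sharpAt G x‖ * ‖ζ‖ ^ 2 * ‖B₁ + B₂‖ * |ζ v| := by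
  refine higherOrder_opNorm_bilin_le (by positivity) fun Y Z ↦ ?_
  rw [_root_.add_apply, _root_.add_apply, _root_.sub_apply, _root_.sub_apply, _root_.smul_apply,
    _root_.smul_apply, _root_.sub_apply, _root_.sub_apply,
    higherOrder_fderiv_ricAt_apply_eq_add_symbol_of_jet₃ hG hG₁ hx h10 h11 h12 hB₁ h13 v Y Z,
    ricAt_apply_eq_add_symbol_of_jets hG hG₂ hx h20 h21 h22 Y Z, add_sub_cancel_left,
    add_sub_cancel_left, smul_eq_mul, ← mul_add, higherOrder_symbolForm_add, abs_mul]
  have hs := higherOrder_abs_symbol_apply_le G x ζ (B₁ + B₂) Y Z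
  calc |ζ v| * _ ≤ |ζ v| * (4 * ‖sharpAt G x‖ * ‖ζ‖ ^ 2 * ‖B₁ + B₂‖ * ‖Y‖ * ‖Z‖) :=
        mul_le_mul_of_nonneg_left hs (abs_nonneg _)
    _ = _ := by ring

/-- **Registered one-line carrier form** (`higherOrder_symbolFormAdd_EF`) of
`higherOrder_symbolForm_add`. [folklore] -/
theorem higherOrder_symbolFormAdd_EF : open Literature.Geometry.Lorentzian MetricCoord in ∀ (G : E4 → E4 →L[ℝ] E4 →L[ℝ] ℝ) (x : E4) (ζ : E4 →L[ℝ] ℝ) (B₁ B₂ : E4 →L[ℝ] E4 →L[ℝ] ℝ) (Y Z : E4), 2⁻¹ * (ζ Z * ζ (sharpAt G x (B₁.flip Y)) + ζ Y * B₁ (sharpAt G x ζ) Z - ζ (sharpAt G x ζ) * B₁ Y Z - ζ Y * ζ Z * mtrAt G x B₁.flip) + 2⁻¹ * (ζ Z * ζ (sharpAt G x (B₂.flip Y)) + ζ Y * B₂ (sharpAt G x ζ) Z - ζ (sharpAt G x ζ) * B₂ Y Z - ζ Y * ζ Z * mtrAt G x B₂.flip) = 2⁻¹ * (ζ Z * ζ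 (sharpAt G x ((B₁ + B₂).flip Y)) + ζ Y * (B₁ + B₂) (sharpAt G x ζ) Z - ζ (sharpAt G x ζ) * (B₁ + B₂) Y Z - ζ Y * ζ Z * mtrAt G x (B₁ + B₂).flip) :=
  fun G x ζ B₁ B₂ Y Z ↦ higherOrder_symbolForm_add G x ζ B₁ B₂ Y Z

end Summit.FinalStateConjecture.FinalStateConjecture.Theorems.SublinearIsFree.Slaving

end
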